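import Mathlib
import Summits.RiemannHypothesis.RiemannHypothesis.Theorems.IntegerScrewChebyshevAbel
import HarnessLib

/-!
# Route `IntegerScrew` — the Green function of the exit-death chain and its bound `Γ(x) ≤ A·log R/log x`
# (CONTINUUM-LIMIT §25.1 (a), §25.3)

The EXIT-DEATH FLOW of CONTINUUM-LIMIT §25 runs the size-biased death chain `x → x/p^a` (probability
`log p/log x` for every prime power `p^a ∣ x`) from the window `W = {Q < x ≤ R}` of the all-integer atom `Ω_R`
until its first exit from `W`.  Its Green function is `G(x) = σ_W(x)·Γ(x)` with

  `Γ(x) = 1 + Σ_{2 ≤ n ≤ R/x} (Λ(n)/n)·Γ(xn)/log(xn)`   (`Q < x ≤ R`),   `Γ(x) = 0` otherwise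

(25.1 (a): every prime power `n` with `xn ≤ R` is an admissible predecessor move, and `σ_W(xn) = σ_W(x)/n`;
no divisibility constraint enters).  Here:

* `exitGamma R Q : ℕ → ℝ` — `Γ`, by well-founded recursion on `R + 1 − x`;
* `exitGamma_of_not_mem`, `exitGamma_eq` — the defining equations; `exitGamma_nonneg`, `one_le_exitGamma`;
* **`exitGamma_le`** — the bound of §25.3: if `Q ≥ 1`, `A ≥ 1` and `A·(1 − (39/50)·log R/log²(Q+1)) ≥ 1`, then
  `Γ(x) ≤ A·log R/log x` on `W` (downward induction with the potential `log R/log x`, the homogeneous solution of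
  the continuum recursion, and the Abel step `IntegerScrewChebyshevAbel.sum_vonMangoldt_div_mul_inv_sq_le`
  against the tree's Chebyshev-strength Mertens bound `ψ₁(N) ≤ log N + 39/50`);
* **`sum_exitGamma_sq_div_le`** — the energy sum of §25.4 (a): `Σ_{Q<x≤R} Γ(x)²/(x log x) ≤
  A² log²R·(1/(2log²Q) − 1/(2log²R))` (= `H_R·ε²·𝓔(F)`; with `log Q = (1−δ)log R` this is `A²δ(2−δ)/(2(1−δ)²)`),
  via `integral_inv_mul_log_cube` (`∫_Q^R dt/(t log³t)`) and the sum–integral comparison — stated under the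
  POINTWISE hypothesis `Γ ≤ A log R/log x` on the window (gen17), so that both `exitGamma_le` (constant `A`,
  `sum_exitGamma_sq_div_le_of_const`) and the sharp bound of `IntegerScrewExitGreenSharp` feed it.

With `Q = R/P`, `log(Q+1) ≥ (1 − δ) log R`, the hypothesis reads `A ≥ (1 − 0.78/((1−δ)² log R))⁻¹ → 1`: the
Green function is at most `(1 + o(1))·log R/log x`, its continuum value (§25.2).  RH-free, elementary.
Nothing in this file bears on the truth of RH.
References: CONTINUUM-LIMIT §25.1–25.3 (rh-explicit A6-PIVOT); M. Suzuki, J. Lond. Math. Soc. (2) 108 (2023)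
1448–1487 [Suzuki2023] for the screw matrices this serves.
-/

noncomputable section

set_option linter.dupNamespace false -- D-0017: `Summit.<S>.<S>.…` is the designed namespace

namespace Summit.RiemannHypothesis.RiemannHypothesis.Theorems.IntegerScrew

open Finset Real
open ArithmeticFunction (vonMangoldt)

/-! ### The Green function `Γ` -/

/-- **The Green function of the exit-death chain** (normalised by `σ_W`): for `Q < x ≤ R`,
`Γ(x) = 1 + Σ_{2 ≤ n ≤ R/x} (Λ(n)/n)·Γ(xn)/log(xn)`, and `Γ(x) = 0` off the window.
[cite: Suzuki2023, §1 (the screw matrices S_M whose pivot/spectral theory this serves)] -/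
def exitGamma (R Q : ℕ) : ℕ → ℝ
  | x =>
    if h : Q < x ∧ x ≤ R then
      1 + ∑ n ∈ (Icc 2 (R / x)).attach,
        vonMangoldt n.1 / n.1 * (exitGamma R Q (x * n.1) / Real.log ((x * n.1 : ℕ) : ℝ))
    else 0
  termination_by x => R + 1 - x
  decreasing_by
    have hn := Finset.mem_Icc.1 n.2
    have hx1 : 0 < x := lt_of_le_of_lt (Nat.zero_le Q) h.1
    have hle : n.1 * x ≤ R := (Nat.le_div_iff_mul_le hx1).1 hn.2
    have hlt : x < n.1 * x := by nlinarith [hn.1]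
    have hcomm : x * n.1 = n.1 * x := mul_comm _ _
    rw [hcomm]
    omega

/-- Off the window `Γ = 0`. -/
theorem exitGamma_of_not_mem {R Q x : ℕ} (h : ¬(Q < x ∧ x ≤ R)) : exitGamma R Q x = 0 := by
  rw [exitGamma.eq_def]
  exact dif_neg h

/-- The defining equation on the window, with a plain `Finset` sum. -/
theorem exitGamma_eq {R Q x : ℕ} (h : Q < x ∧ x ≤ R) :
    exitGamma R Q x = 1 + ∑ n ∈ Icc 2 (R / x),
      vonMangoldt n / n * (exitGamma R Q (x * n) / Real.log ((x * n : ℕ) : ℝ)) := by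
  conv_lhs => rw [exitGamma.eq_def]
  rw [dif_pos h]
  congr 1
  exact Finset.sum_attach (Icc 2 (R / x))
    (fun n => vonMangoldt n / n * (exitGamma R Q (x * n) / Real.log ((x * n : ℕ) : ℝ)))

/-- `Γ ≥ 0` everywhere (downward induction). -/
theorem exitGamma_nonneg (R Q : ℕ) : ∀ x, 0 ≤ exitGamma R Q x := by
  -- strong induction on `R + 1 − x`
  suffices H : ∀ k x, R + 1 - x = k → 0 ≤ exitGamma R Q x from fun x => H _ x rfl
  intro k
  induction k using Nat.strong_induction_on with
  | _ k ih =>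
    intro x hk
    by_cases h : Q < x ∧ x ≤ R
    · rw [exitGamma_eq h]
      refine add_nonneg zero_le_one (Finset.sum_nonneg fun n hn => ?_)
      have hn' := Finset.mem_Icc.1 hn
      have hx1 : 1 ≤ x := by omega
      have hxn : x * n ≤ R := by
        have := (Nat.le_div_iff_mul_le (by omega)).1 hn'.2
        rwa [mul_comm] at this
      have hlt : x < x * n := by nlinarith [hn'.1]
      have hG : 0 ≤ exitGamma R Q (x * n) := ih (R + 1 - x * n) (by omega) _ rfl
      have hlog : 0 ≤ Real.log ((x * n : ℕ) : ℝ) := Real.log_natCast_nonneg _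
      exact mul_nonneg (div_nonneg ArithmeticFunction.vonMangoldt_nonneg (Nat.cast_nonneg _))
        (div_nonneg hG hlog)
    · rw [exitGamma_of_not_mem h]

/-- `Γ ≥ 1` on the window. -/
theorem one_le_exitGamma {R Q x : ℕ} (h : Q < x ∧ x ≤ R) : 1 ≤ exitGamma R Q x := by
  rw [exitGamma_eq h]
  refine le_add_of_nonneg_right (Finset.sum_nonneg fun n _ => ?_)
  exact mul_nonneg (div_nonneg ArithmeticFunction.vonMangoldt_nonneg (Nat.cast_nonneg _))
    (div_nonneg (exitGamma_nonneg R Q _) (Real.log_natCast_nonneg _))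

/-! ### The bound `Γ(x) ≤ A·log R/log x` -/

/-- **The Green-function bound (CONTINUUM-LIMIT §25.3).**  Let `1 ≤ Q`, `1 ≤ A` and
`1 ≤ A·(1 − (39/50)·log R/log²(Q+1))`.  Then for every `Q < x ≤ R`: `Γ(x) ≤ A·log R/log x`.
Proof: downward induction on `x`; on the window `Γ(x) = 1 + Σ_{n ≤ R/x}(Λ(n)/n)Γ(xn)/log(xn)
≤ 1 + Σ (Λ(n)/n)·A log R/(log x + log n)² ≤ 1 + (39/50)A log R/log²x + A log R·(1/log x − 1/log R)` by
`sum_vonMangoldt_div_mul_inv_sq_le`, and `1 − A + (39/50)A log R/log²x ≤ 0` by the hypothesis on `A`. -/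
theorem exitGamma_le {R Q : ℕ} (hQ : 1 ≤ Q) {A : ℝ} (hA1 : 1 ≤ A)
    (hA : 1 ≤ A * (1 - 39 / 50 * Real.log R / Real.log ((Q : ℝ) + 1) ^ 2)) :
    ∀ x, Q < x → x ≤ R → exitGamma R Q x ≤ A * Real.log R / Real.log x := by
  suffices H : ∀ k x, R + 1 - x = k → Q < x → x ≤ R → exitGamma R Q x ≤ A * Real.log R / Real.log x from
    fun x hQx hxR => H _ x rfl hQx hxR
  intro k
  induction k using Nat.strong_induction_on with
  | _ k ih =>
    intro x hk hQx hxR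
    have hx2 : (2 : ℝ) ≤ x := by exact_mod_cast (show 2 ≤ x by omega)
    have hxR' : (x : ℝ) ≤ R := by exact_mod_cast hxR
    have hlogx : 0 < Real.log x := Real.log_pos (by linarith)
    have hlogQ1 : Real.log ((Q : ℝ) + 1) ≤ Real.log x :=
      Real.log_le_log (by positivity) (by exact_mod_cast hQx)
    have hlogQ1pos : 0 < Real.log ((Q : ℝ) + 1) := Real.log_pos (by
      have : (1 : ℝ) ≤ Q := by exact_mod_cast hQ
      linarith)
    have hL : Real.log x ≤ Real.log R := Real.log_le_log (by linarith) hxR'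
    have hLnn : 0 ≤ Real.log R := hlogx.le.trans hL
    have hA0 : 0 ≤ A := zero_le_one.trans hA1
    set L := Real.log R with hLdef
    set s := Real.log x with hs
    rw [exitGamma_eq ⟨hQx, hxR⟩]
    -- Step 1: the induction hypothesis inside the sum
    have hsum : ∑ n ∈ Icc 2 (R / x), vonMangoldt n / n * (exitGamma R Q (x * n) / Real.log ((x * n : ℕ) : ℝ)) ≤
        ∑ n ∈ Icc 2 (R / x), vonMangoldt n / n * (A * L / (s + Real.log n) ^ 2) := by
      refine Finset.sum_le_sum fun n hn => ?_
      have hn' := Finset.mem_Icc.1 hn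
      have hxn : x * n ≤ R := by
        have := (Nat.le_div_iff_mul_le (by omega)).1 hn'.2
        rwa [mul_comm] at this
      have hlt : x < x * n := by nlinarith [hn'.1]
      have hQxn : Q < x * n := lt_trans hQx hlt
      have hG := ih (R + 1 - x * n) (by omega) (x * n) rfl hQxn hxn
      have hn2 : (2 : ℝ) ≤ n := by exact_mod_cast hn'.1
      have hlogn : 0 < Real.log n := Real.log_pos (by linarith)
      have hlogxn : Real.log ((x * n : ℕ) : ℝ) = s + Real.log n := by
        push_cast
        rw [Real.log_mul (by positivity) (by positivity)]
      refine mul_le_mul_of_nonneg_left ?_ (div_nonneg ArithmeticFunction.vonMangoldt_nonneg (Nat.cast_nonneg _))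
      rw [hlogxn]
      have hpos : 0 < s + Real.log n := by linarith
      calc exitGamma R Q (x * n) / (s + Real.log n) ≤ (A * L / Real.log ((x * n : ℕ) : ℝ)) / (s + Real.log n) :=
            div_le_div_of_nonneg_right hG hpos.le
        _ = A * L / (s + Real.log n) ^ 2 := by rw [hlogxn, div_div, sq]
    -- Step 2: the Abel step
    have hRx : 1 ≤ R / x := Nat.div_pos hxR (by omega)
    have hAL : 0 ≤ A * L := mul_nonneg hA0 hLnn
    have habel := sum_vonMangoldt_div_mul_inv_sq_le (N := R / x) hRx hlogx hAL
    -- Icc 1 N ⊇ Icc 2 N and the n = 1 term vanishes (Λ(1) = 0)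
    have hdrop : ∑ n ∈ Icc 2 (R / x), vonMangoldt n / n * (A * L / (s + Real.log n) ^ 2) =
        ∑ n ∈ Icc 1 (R / x), vonMangoldt n / n * (A * L / (s + Real.log n) ^ 2) := by
      have hI : Icc 1 (R / x) = insert 1 (Icc 2 (R / x)) := by
        ext n; simp only [Finset.mem_insert, Finset.mem_Icc]; omega
      rw [hI, Finset.sum_insert (by simp)]
      simp [ArithmeticFunction.vonMangoldt_apply_one]
    -- Step 3: 1/(s + log N) ≥ 1/L
    have hN : s + Real.log ((R / x : ℕ) : ℝ) ≤ L := by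
      have hprod : (x : ℝ) * ((R / x : ℕ) : ℝ) ≤ R := by exact_mod_cast Nat.mul_div_le R x
      have hNpos : (0 : ℝ) < ((R / x : ℕ) : ℝ) := by exact_mod_cast hRx
      rw [hs, hLdef, ← Real.log_mul (by positivity) hNpos.ne']
      exact Real.log_le_log (by positivity) hprod
    have hinv : 1 / L ≤ 1 / (s + Real.log ((R / x : ℕ) : ℝ)) := by
      have hpos : 0 < s + Real.log ((R / x : ℕ) : ℝ) := by
        have := Real.log_natCast_nonneg (R / x); linarith
      exact one_div_le_one_div_of_le hpos hN
    -- Step 4: the potential inequality  1 − A + (39/50) A L/s² ≤ 0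
    have hkey : 1 + (39 / 50 * (A * L / s ^ 2) + A * L * (1 / s - 1 / L)) ≤ A * L / s := by
      have hs2 : Real.log ((Q : ℝ) + 1) ^ 2 ≤ s ^ 2 := pow_le_pow_left₀ hlogQ1pos.le hlogQ1 2
      have hfrac : 39 / 50 * L / s ^ 2 ≤ 39 / 50 * L / Real.log ((Q : ℝ) + 1) ^ 2 :=
        div_le_div_of_nonneg_left (by positivity) (by positivity) hs2
      have h1 : 1 ≤ A * (1 - 39 / 50 * L / s ^ 2) := by
        calc (1 : ℝ) ≤ A * (1 - 39 / 50 * L / Real.log ((Q : ℝ) + 1) ^ 2) := hA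
          _ ≤ A * (1 - 39 / 50 * L / s ^ 2) := mul_le_mul_of_nonneg_left (by linarith) hA0
      rcases eq_or_lt_of_le hLnn with hL0 | hLpos
      · -- L = 0: then s = 0 impossible (s > 0 ≤ … ≤ L); so this case is vacuous
        exfalso; rw [← hL0] at hL; linarith
      · have hAL' : A * L * (1 / s - 1 / L) = A * L / s - A := by field_simp
        rw [hAL']
        have h2 : 39 / 50 * (A * L / s ^ 2) = A * (39 / 50 * L / s ^ 2) := by ring
        rw [h2]
        nlinarith [h1]
    calc 1 + ∑ n ∈ Icc 2 (R / x), vonMangoldt n / n * (exitGamma R Q (x * n) / Real.log ((x * n : ℕ) : ℝ))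
        ≤ 1 + ∑ n ∈ Icc 1 (R / x), vonMangoldt n / n * (A * L / (s + Real.log n) ^ 2) := by
          rw [← hdrop]; linarith [hsum]
      _ ≤ 1 + (39 / 50 * (A * L / s ^ 2) + A * L * (1 / s - 1 / (s + Real.log ((R / x : ℕ) : ℝ)))) := by
          linarith [habel]
      _ ≤ 1 + (39 / 50 * (A * L / s ^ 2) + A * L * (1 / s - 1 / L)) := by
          nlinarith [hinv, hAL]
      _ ≤ A * L / s := hkey

/-! ### The energy sum `Σ_{Q<x≤R} Γ(x)²/(x log x)` (CONTINUUM-LIMIT §25.4 (a)) -/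

/-- `∫_Q^R dt/(t log³t) = 1/(2 log²Q) − 1/(2 log²R)` for `1 < Q ≤ R`. -/
theorem integral_inv_mul_log_cube {Q R : ℝ} (hQ : 1 < Q) (hQR : Q ≤ R) :
    ∫ t in Q..R, 1 / (t * Real.log t ^ 3) = 1 / (2 * Real.log Q ^ 2) - 1 / (2 * Real.log R ^ 2) := by
  have hderiv : ∀ t ∈ Set.uIcc Q R,
      HasDerivAt (fun t => -(1 / (2 * Real.log t ^ 2))) (1 / (t * Real.log t ^ 3)) t := by
    intro t ht
    rw [Set.uIcc_of_le hQR] at ht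
    have ht1 : 1 < t := lt_of_lt_of_le hQ ht.1
    have ht0 : t ≠ 0 := by linarith
    have hlog : Real.log t ≠ 0 := (Real.log_pos ht1).ne'
    have h1 : HasDerivAt (fun y => Real.log y ^ 2) (((2 : ℕ) : ℝ) * Real.log t ^ (2 - 1) * t⁻¹) t :=
      (Real.hasDerivAt_log ht0).pow 2
    have h2 : HasDerivAt (fun y => -(1 / 2 : ℝ) * (Real.log y ^ 2)⁻¹)
        (-(1 / 2 : ℝ) * (-(((2 : ℕ) : ℝ) * Real.log t ^ (2 - 1) * t⁻¹) / (Real.log t ^ 2) ^ 2)) t :=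
      (h1.inv (pow_ne_zero 2 hlog)).const_mul (-(1 / 2 : ℝ))
    have hfun : (fun t => -(1 / (2 * Real.log t ^ 2))) = fun y => -(1 / 2 : ℝ) * (Real.log y ^ 2)⁻¹ := by
      funext y; ring
    rw [hfun]
    refine h2.congr_deriv ?_
    push_cast
    field_simp
  have hcont : ContinuousOn (fun t => 1 / (t * Real.log t ^ 3)) (Set.uIcc Q R) := by
    refine ContinuousOn.div continuousOn_const (ContinuousOn.mul continuousOn_id
      ((Real.continuousOn_log.mono ?_).pow 3)) ?_
    · intro t ht
      rw [Set.uIcc_of_le hQR] at ht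
      exact ne_of_gt (lt_trans zero_lt_one (lt_of_lt_of_le hQ ht.1))
    · intro t ht
      rw [Set.uIcc_of_le hQR] at ht
      have ht1 : 1 < t := lt_of_lt_of_le hQ ht.1
      exact mul_ne_zero (by linarith) (pow_ne_zero 3 (Real.log_pos ht1).ne')
  rw [intervalIntegral.integral_eq_sub_of_hasDerivAt hderiv hcont.intervalIntegrable]
  ring

/-- `t ↦ 1/(t log³t)` is antitone on `[Q, R]` for `Q > 1`. -/
theorem antitoneOn_inv_mul_log_cube {Q R : ℝ} (hQ : 1 < Q) :
    AntitoneOn (fun t => 1 / (t * Real.log t ^ 3)) (Set.Icc Q R) := by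
  intro x hx y hy hxy
  have hx1 : 1 < x := lt_of_lt_of_le hQ hx.1
  have hy1 : 1 < y := lt_of_lt_of_le hQ hy.1
  have hlx : 0 < Real.log x := Real.log_pos hx1
  have hlxy : Real.log x ≤ Real.log y := Real.log_le_log (by linarith) hxy
  have hden : x * Real.log x ^ 3 ≤ y * Real.log y ^ 3 :=
    mul_le_mul hxy (pow_le_pow_left₀ hlx.le hlxy 3) (by positivity) (by linarith)
  exact one_div_le_one_div_of_le (by positivity) hden

/-- **The energy sum of the exit-death flow (CONTINUUM-LIMIT §25.4 (a)).**  Under the hypotheses of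
`exitGamma_le` and `2 ≤ Q ≤ R`:
`Σ_{Q < x ≤ R} Γ(x)²/(x log x) ≤ A² log²R·(1/(2 log²Q) − 1/(2 log²R))` under the POINTWISE hypothesis
`Γ(x) ≤ A·log R/log x` on the window (supplied by `exitGamma_le`, or by `IntegerScrewExitGreenSharp.exitGamma_le_sharp'`
with `A = 1 + κ/log(Q+1)` and no restriction on the window)
(`Γ² ≤ A² log²R/log²x` termwise, then the sum–integral comparison for the antitone `1/(t log³t)`).
With `ε²·𝓔(F) = H_R⁻¹·(this sum)` and `log Q = (1−δ) log R` the right side is `A²δ(2−δ)/(2(1−δ)²)`. -/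
theorem sum_exitGamma_sq_div_le {R Q : ℕ} (hQ : 2 ≤ Q) (hQR : Q ≤ R) {A : ℝ}
    (hΓU : ∀ x, Q < x → x ≤ R → exitGamma R Q x ≤ A * Real.log R / Real.log x) :
    ∑ x ∈ Ioc Q R, exitGamma R Q x ^ 2 / (x * Real.log x) ≤
      A ^ 2 * Real.log R ^ 2 * (1 / (2 * Real.log Q ^ 2) - 1 / (2 * Real.log R ^ 2)) := by
  have hQ1 : (1 : ℝ) < Q := by exact_mod_cast (show 1 < Q by omega)
  have hQR' : (Q : ℝ) ≤ R := by exact_mod_cast hQR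
  -- termwise bound
  have hterm : ∀ x ∈ Ioc Q R, exitGamma R Q x ^ 2 / (x * Real.log x) ≤
      A ^ 2 * Real.log R ^ 2 * (1 / (x * Real.log x ^ 3)) := by
    intro x hx
    have hx' := Finset.mem_Ioc.1 hx
    have hx1 : (1 : ℝ) < x := lt_of_lt_of_le hQ1 (by exact_mod_cast hx'.1.le)
    have hlogx : 0 < Real.log x := Real.log_pos hx1
    have hG0 : 0 ≤ exitGamma R Q x := exitGamma_nonneg R Q x
    have hG := hΓU x hx'.1 hx'.2
    have hGsq : exitGamma R Q x ^ 2 ≤ (A * Real.log R / Real.log x) ^ 2 := pow_le_pow_left₀ hG0 hG 2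
    calc exitGamma R Q x ^ 2 / (x * Real.log x) ≤ (A * Real.log R / Real.log x) ^ 2 / (x * Real.log x) :=
          div_le_div_of_nonneg_right hGsq (by positivity)
      _ = A ^ 2 * Real.log R ^ 2 * (1 / (x * Real.log x ^ 3)) := by
          field_simp
  -- sum–integral comparison
  have hanti := antitoneOn_inv_mul_log_cube (R := (R : ℝ)) hQ1
  have hcmp := AntitoneOn.sum_le_integral_Ico hQR hanti
  have hre : ∑ x ∈ Ioc Q R, (1 / ((x : ℝ) * Real.log x ^ 3)) =
      ∑ i ∈ Finset.Ico Q R, (1 / (((i + 1 : ℕ) : ℝ) * Real.log ((i + 1 : ℕ) : ℝ) ^ 3)) := by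
    refine Finset.sum_nbij' (fun x => x - 1) (fun i => i + 1) ?_ ?_ ?_ ?_ ?_
    · intro x hx; simp only [Finset.mem_Ioc] at hx; simp only [Finset.mem_Ico]; omega
    · intro i hi; simp only [Finset.mem_Ico] at hi; simp only [Finset.mem_Ioc]; omega
    · intro x hx; simp only [Finset.mem_Ioc] at hx; omega
    · intro i hi; omega
    · intro x hx
      simp only [Finset.mem_Ioc] at hx
      have : x - 1 + 1 = x := by omega
      rw [this]
  rw [integral_inv_mul_log_cube hQ1 hQR'] at hcmp
  calc ∑ x ∈ Ioc Q R, exitGamma R Q x ^ 2 / (x * Real.log x)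
      ≤ ∑ x ∈ Ioc Q R, A ^ 2 * Real.log R ^ 2 * (1 / (x * Real.log x ^ 3)) := Finset.sum_le_sum hterm
    _ = A ^ 2 * Real.log R ^ 2 * ∑ x ∈ Ioc Q R, (1 / ((x : ℝ) * Real.log x ^ 3)) := by rw [Finset.mul_sum]
    _ ≤ A ^ 2 * Real.log R ^ 2 * (1 / (2 * Real.log Q ^ 2) - 1 / (2 * Real.log R ^ 2)) := by
        refine mul_le_mul_of_nonneg_left ?_ (by positivity)
        rw [hre]
        push_cast at hcmp ⊢
        exact hcmp

/-- `sum_exitGamma_sq_div_le` with the constant-`A` Green bound of `exitGamma_le`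
(`1 ≤ A`, `1 ≤ A(1 − (39/50)log R/log²(Q+1))`). -/
theorem sum_exitGamma_sq_div_le_of_const {R Q : ℕ} (hQ : 2 ≤ Q) (hQR : Q ≤ R) {A : ℝ} (hA1 : 1 ≤ A)
    (hA : 1 ≤ A * (1 - 39 / 50 * Real.log R / Real.log ((Q : ℝ) + 1) ^ 2)) :
    ∑ x ∈ Ioc Q R, exitGamma R Q x ^ 2 / (x * Real.log x) ≤
      A ^ 2 * Real.log R ^ 2 * (1 / (2 * Real.log Q ^ 2) - 1 / (2 * Real.log R ^ 2)) :=
  sum_exitGamma_sq_div_le hQ hQR (exitGamma_le (by omega) hA1 hA)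

end Summit.RiemannHypothesis.RiemannHypothesis.Theorems.IntegerScrew


end
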